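import Mathlib
import Summits.AtomisticToContinuum.Crystallization.Theorems.GappedShellCensusFiveFoldRationingRStubFfrC5CoreTools

/-!
# Crux `GappedShellCensus.FiveFoldRationingR` (stmt-AtomisticToContinuum-18071), line `Sketch` —
# stub `stub_ffrC5Core` (the finite core of the capped census),
# file 2/6: the link pentagon of a `5`-valent label (registered sub-goal `stub_ffrC5CorePentagon`)

Setting (abstract fan data on the twelve labels `Fin 12`): a family `tri` of `3`-element label sets,
two per side, and a symmetric irreflexive Boolean bond relation with degrees in `{4, 5}`; every bond
is a side of exactly two members of `tri`, every bonded `3`-clique is in `tri`, every member of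
`tri` has a vertex bonded to the other two, every `5`-valent label has only bonded fan triangles and
every `4`-valent label at most two.

This file: for a `5`-valent label `v` all of whose fan triangles are bonded, the two fan triangles
on each bond `{v, a}` are `{v, a, b}` with `b` again a partner of `v`, so "third vertex" is a
`2`-regular graph on the five partners; a `2`-regular graph on five vertices is a pentagon (a
triangle plus a digon is excluded by walking: the saturation argument `sat`).  `ffrCC_pentagon`
enumerates the partners as `u 0, …, u 4` with the fan triangles at `v` being exactly the five sets
`{v, u i, u (i + 1)}` (indices mod `5`).
-/

noncomputable section

namespace Summit.AtomisticToContinuum.Crystallization.Theorems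

open Finset

section FanData

variable {bond : Fin 12 → Fin 12 → Bool} {tri : Finset (Finset (Fin 12))}
  (bond_irrefl : ∀ v, bond v v = false)
  (tri_card : ∀ S ∈ tri, S.card = 3)
  (bond_side : ∀ v w, bond v w = true →
    (tri.filter fun S' => ({v, w} : Finset (Fin 12)) ⊆ S').card = 2)
  (five_T : ∀ v, (Finset.univ.filter fun w => bond v w = true).card = 5 →
    ∀ S ∈ tri, v ∈ S → ∀ a ∈ S, ∀ b ∈ S, a ≠ b → bond a b = true)

include bond_irrefl tri_card bond_side five_T in
/-- **The link pentagon of a `5`-valent label.**  If every bond `{v, w}` is a side of exactly two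
fan triangles, fan triangles have three vertices, and all fan triangles at the `5`-valent label `v`
are bonded, then the five partners of `v` can be enumerated as `u 0, …, u 4` so that the fan
triangles at `v` are exactly the five sets `{v, u i, u (i + 1)}` (indices mod `5`). [folklore] -/
theorem ffrCC_pentagon (v : Fin 12) (hv : (Finset.univ.filter fun w => bond v w = true).card = 5) :
    ∃ u : Fin 5 → Fin 12, Function.Injective u ∧ (∀ i, bond v (u i) = true) ∧
      (∀ a, bond v a = true → ∃ i, u i = a) ∧
      (∀ i, ({v, u i, u (i + 1)} : Finset (Fin 12)) ∈ tri) ∧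
      (∀ S ∈ tri, v ∈ S → ∃ i, S = {v, u i, u (i + 1)}) := by
  -- partners of `v` are not `v`
  have neN : ∀ a, bond v a = true → a ≠ v := by
    rintro a h rfl
    rw [bond_irrefl] at h
    exact Bool.false_ne_true h
  -- membership in the side filter
  have memP : ∀ a S, S ∈ tri.filter (fun S' => ({v, a} : Finset (Fin 12)) ⊆ S') ↔
      S ∈ tri ∧ v ∈ S ∧ a ∈ S := by
    intro a S
    simp only [Finset.mem_filter, Finset.insert_subset_iff, Finset.singleton_subset_iff]
  -- any fan triangle through `v` and a partner `a` is one of two given distinct ones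
  have only2 : ∀ a S₁ S₂ S, bond v a = true → S₁ ∈ tri → v ∈ S₁ → a ∈ S₁ → S₂ ∈ tri → v ∈ S₂ →
      a ∈ S₂ → S₁ ≠ S₂ → S ∈ tri → v ∈ S → a ∈ S → S = S₁ ∨ S = S₂ := by
    intro a S₁ S₂ S ha h1 hv1 ha1 h2 hv2 ha2 hne hS hvS haS
    exact ffrCC_of_card_two (bond_side v a ha) ((memP a S₁).2 ⟨h1, hv1, ha1⟩)
      ((memP a S₂).2 ⟨h2, hv2, ha2⟩) hne ((memP a S).2 ⟨hS, hvS, haS⟩)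
  -- the third vertex of a fan triangle through `v` and a partner `a`
  have third : ∀ a S, bond v a = true → S ∈ tri → v ∈ S → a ∈ S →
      ∃ b, b ≠ v ∧ b ≠ a ∧ S = {v, a, b} ∧ bond v b = true := by
    intro a S ha hS hvS haS
    obtain ⟨b, hbv, hba, rfl⟩ := eq_three_of_two_mem (tri_card _ hS) hvS haS (neN a ha).symm
    exact ⟨b, hbv, hba, rfl, five_T v hv _ hS hvS v hvS b (by simp) hbv.symm⟩
  -- a second fan triangle through `v` and a partner `a`
  have next : ∀ a S, bond v a = true → S ∈ tri → v ∈ S → a ∈ S →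
      ∃ b S', S' ∈ tri ∧ S' ≠ S ∧ S' = {v, a, b} ∧ b ≠ v ∧ b ≠ a ∧ bond v b = true := by
    intro a S ha hS hvS haS
    obtain ⟨S', hS', hne⟩ :=
      ffrCC_other_of_card_two (bond_side v a ha) ((memP a S).2 ⟨hS, hvS, haS⟩)
    obtain ⟨h1, h2, h3⟩ := (memP a S').1 hS'
    obtain ⟨b, hbv, hba, heq, hb⟩ := third a S' ha h1 h2 h3
    exact ⟨b, S', h1, hne, heq, hbv, hba, hb⟩
  -- some fan triangle through `v` and a partner `a`
  have first : ∀ a, bond v a = true →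
      ∃ b S, S ∈ tri ∧ S = {v, a, b} ∧ b ≠ v ∧ b ≠ a ∧ bond v b = true := by
    intro a ha
    have hne : (tri.filter fun S' => ({v, a} : Finset (Fin 12)) ⊆ S').Nonempty := by
      rw [← Finset.card_pos, bond_side v a ha]; norm_num
    obtain ⟨S, hS⟩ := hne
    obtain ⟨h1, h2, h3⟩ := (memP a S).1 hS
    obtain ⟨b, hbv, hba, heq, hb⟩ := third a S ha h1 h2 h3
    exact ⟨b, S, h1, heq, hbv, hba, hb⟩
  -- there is a partner outside any set with fewer than five elements
  have exK : ∀ K : Finset (Fin 12), K.card < 5 → ∃ a, bond v a = true ∧ a ∉ K := by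
    intro K hK
    by_contra hno
    simp only [not_exists, not_and, not_not] at hno
    have hsub : (Finset.univ.filter fun w => bond v w = true) ⊆ K := by
      intro a ha
      simp only [Finset.mem_filter, Finset.mem_univ, true_and] at ha
      exact hno a ha
    have := Finset.card_le_card hsub
    omega
  -- saturation: a closed set of partners missing one or two partners is impossible
  have sat : ∀ K : Finset (Fin 12), (∃ a, bond v a = true ∧ a ∉ K) →
      ((Finset.univ.filter fun w => bond v w = true) \ K).card ≤ 2 →
      (∀ k ∈ K, ∀ S ∈ tri, v ∈ S → k ∈ S → ∀ z ∈ S, z = v ∨ z ∈ K) → False := by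
    intro K ⟨a, ha, haK⟩ hcard hcl
    obtain ⟨b, S, hS, hSeq, hbv, hba, hb⟩ := first a ha
    obtain ⟨b', S', hS', hS'S, hS'eq, hb'v, hb'a, hb'⟩ :=
      next a S ha hS (by rw [hSeq]; simp) (by rw [hSeq]; simp)
    have out : ∀ c T, T ∈ tri → T = ({v, a, c} : Finset (Fin 12)) → c ∉ K := by
      intro c T hT hTeq hcK
      rcases hcl c hcK T hT (by rw [hTeq]; simp) (by rw [hTeq]; simp) a (by rw [hTeq]; simp)
        with h | h
      · exact neN a ha h
      · exact haK h
    have memD : ∀ c, bond v c = true → c ∉ K →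
        c ∈ (Finset.univ.filter fun w => bond v w = true) \ K := by
      intro c hc hcK
      simp [hc, hcK]
    rcases eq_or_ne b b' with hbb | hbb
    · exact hS'S (by rw [hS'eq, hSeq, hbb])
    · exact ffrCC_absurd_of_card_le_two hcard (memD a ha haK) (memD b hb (out b S hS hSeq))
        (memD b' hb' (out b' S' hS' hS'eq)) hba.symm hb'a.symm hbb
  -- START of the walk: a partner `u0`, fan triangles `S0 = {v,u0,u1}` and `S4 = {v,u0,u4}`
  have hNne : (Finset.univ.filter fun w => bond v w = true).Nonempty := by
    rw [← Finset.card_pos, hv]; norm_num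
  obtain ⟨u0, hu0N⟩ := hNne
  have hu0 : bond v u0 = true := by simpa using hu0N
  obtain ⟨u1, S0, hS0, hS0eq, hu1v, hu10, hu1⟩ := first u0 hu0
  have mS0 : ∀ z, z ∈ S0 ↔ z = v ∨ z = u0 ∨ z = u1 := by
    intro z; rw [hS0eq]; simp only [Finset.mem_insert, Finset.mem_singleton]
  obtain ⟨u4, S4, hS4, hS40, hS4eq, hu4v, hu40, hu4⟩ :=
    next u0 S0 hu0 hS0 ((mS0 v).2 (Or.inl rfl)) ((mS0 u0).2 (by simp))
  have mS4 : ∀ z, z ∈ S4 ↔ z = v ∨ z = u0 ∨ z = u4 := by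
    intro z; rw [hS4eq]; simp only [Finset.mem_insert, Finset.mem_singleton]
  have hu14 : u1 ≠ u4 := by
    intro h; apply hS40; rw [hS4eq, hS0eq, h]
  -- the second fan triangle on `{v,u1}`: `S1 = {v,u1,u2}`
  obtain ⟨u2, S1, hS1, hS10, hS1eq, hu2v, hu21, hu2⟩ :=
    next u1 S0 hu1 hS0 ((mS0 v).2 (Or.inl rfl)) ((mS0 u1).2 (by simp))
  have mS1 : ∀ z, z ∈ S1 ↔ z = v ∨ z = u1 ∨ z = u2 := by
    intro z; rw [hS1eq]; simp only [Finset.mem_insert, Finset.mem_singleton]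
  have hu20 : u2 ≠ u0 := by
    intro h; apply hS10; rw [hS1eq, hS0eq, h, tri_swap23]
  have hS4S1 : u2 = u4 → S4 ≠ S1 := by
    intro h24 he
    have := (mS4 u0).2 (Or.inr (Or.inl rfl))
    rw [he, mS1] at this
    rcases this with h1 | h1 | h1
    · exact (neN u0 hu0) h1
    · exact hu10 h1.symm
    · exact hu20 h1.symm
  -- `u2 ≠ u4` by saturation of `{u0, u1, u4}`
  have hu24 : u2 ≠ u4 := by
    intro h24
    refine sat {u0, u1, u4} (exK _ (lt_of_le_of_lt Finset.card_le_three (by norm_num))) ?_ ?_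
    · have hKsub : ({u0, u1, u4} : Finset (Fin 12)) ⊆
          Finset.univ.filter fun w => bond v w = true := by
        intro k hk
        simp only [Finset.mem_insert, Finset.mem_singleton] at hk
        simp only [Finset.mem_filter, Finset.mem_univ, true_and]
        rcases hk with h | h | h <;> rw [h] <;> assumption
      rw [Finset.card_sdiff_of_subset hKsub, hv,
        Finset.card_eq_three.2 ⟨u0, u1, u4, hu10.symm, hu40.symm, hu14, rfl⟩]
    · intro k hk S hS hvS hkS z hz
      simp only [Finset.mem_insert, Finset.mem_singleton] at hk ⊢
      rcases hk with h | h | h <;> rw [h] at hkS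
      · rcases only2 u0 S0 S4 S hu0 hS0 ((mS0 v).2 (Or.inl rfl)) ((mS0 u0).2 (by simp)) hS4
            ((mS4 v).2 (Or.inl rfl)) ((mS4 u0).2 (by simp)) (Ne.symm hS40) hS hvS hkS with h' | h'
        · rw [h', mS0] at hz
          rcases hz with hz | hz | hz <;> simp only [hz, true_or, or_true]
        · rw [h', mS4] at hz
          rcases hz with hz | hz | hz <;> simp only [hz, true_or, or_true]
      · rcases only2 u1 S0 S1 S hu1 hS0 ((mS0 v).2 (Or.inl rfl)) ((mS0 u1).2 (by simp)) hS1
            ((mS1 v).2 (Or.inl rfl)) ((mS1 u1).2 (by simp)) (Ne.symm hS10) hS hvS hkS with h' | h'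
        · rw [h', mS0] at hz
          rcases hz with hz | hz | hz <;> simp only [hz, true_or, or_true]
        · rw [h', mS1, h24] at hz
          rcases hz with hz | hz | hz <;> simp only [hz, true_or, or_true]
      · rcases only2 u4 S4 S1 S hu4 hS4 ((mS4 v).2 (Or.inl rfl)) ((mS4 u4).2 (by simp)) hS1
            ((mS1 v).2 (Or.inl rfl)) ((mS1 u4).2 (by rw [← h24]; simp)) (hS4S1 h24) hS hvS hkS
            with h' | h'
        · rw [h', mS4] at hz
          rcases hz with hz | hz | hz <;> simp only [hz, true_or, or_true]
        · rw [h', mS1, h24] at hz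
          rcases hz with hz | hz | hz <;> simp only [hz, true_or, or_true]
  -- the second fan triangle on `{v,u2}`: `S2 = {v,u2,u3}`
  obtain ⟨u3, S2, hS2, hS21, hS2eq, hu3v, hu32, hu3⟩ :=
    next u2 S1 hu2 hS1 ((mS1 v).2 (Or.inl rfl)) ((mS1 u2).2 (by simp))
  have mS2 : ∀ z, z ∈ S2 ↔ z = v ∨ z = u2 ∨ z = u3 := by
    intro z; rw [hS2eq]; simp only [Finset.mem_insert, Finset.mem_singleton]
  have hu31 : u3 ≠ u1 := by
    intro h; apply hS21; rw [hS2eq, hS1eq, h, tri_swap23]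
  have hu30 : u3 ≠ u0 := by
    intro h
    rcases only2 u0 S0 S4 S2 hu0 hS0 ((mS0 v).2 (Or.inl rfl)) ((mS0 u0).2 (by simp)) hS4
        ((mS4 v).2 (Or.inl rfl)) ((mS4 u0).2 (by simp)) (Ne.symm hS40) hS2 ((mS2 v).2 (Or.inl rfl))
        ((mS2 u0).2 (by rw [← h]; simp)) with h' | h'
    · have := (mS2 u2).2 (Or.inr (Or.inl rfl))
      rw [h', mS0] at this
      rcases this with h1 | h1 | h1
      exacts [hu2v h1, hu20 h1, hu21 h1]
    · have := (mS2 u2).2 (Or.inr (Or.inl rfl))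
      rw [h', mS4] at this
      rcases this with h1 | h1 | h1
      exacts [hu2v h1, hu20 h1, hu24 h1]
  have hS4S2 : u3 = u4 → S4 ≠ S2 := by
    intro h34 he
    have := (mS4 u0).2 (Or.inr (Or.inl rfl))
    rw [he, mS2] at this
    rcases this with h1 | h1 | h1
    · exact (neN u0 hu0) h1
    · exact hu20 h1.symm
    · exact hu30 h1.symm
  -- `u3 ≠ u4` by saturation of `{u0, u1, u2, u4}`
  have hu34 : u3 ≠ u4 := by
    intro h34
    refine sat {u0, u1, u2, u4} (exK _ (lt_of_le_of_lt Finset.card_le_four (by norm_num))) ?_ ?_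
    · have hKsub : ({u0, u1, u2, u4} : Finset (Fin 12)) ⊆
          Finset.univ.filter fun w => bond v w = true := by
        intro k hk
        simp only [Finset.mem_insert, Finset.mem_singleton] at hk
        simp only [Finset.mem_filter, Finset.mem_univ, true_and]
        rcases hk with h | h | h | h <;> rw [h] <;> assumption
      have h3 : 3 ≤ ({u0, u1, u2, u4} : Finset (Fin 12)).card := by
        have hsub : ({u0, u1, u4} : Finset (Fin 12)) ⊆ {u0, u1, u2, u4} := by
          intro k hk
          simp only [Finset.mem_insert, Finset.mem_singleton] at hk ⊢
          rcases hk with hk | hk | hk <;> simp only [hk, true_or, or_true]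
        have := Finset.card_le_card hsub
        rwa [Finset.card_eq_three.2 ⟨u0, u1, u4, hu10.symm, hu40.symm, hu14, rfl⟩] at this
      rw [Finset.card_sdiff_of_subset hKsub, hv]
      omega
    · intro k hk S hS hvS hkS z hz
      simp only [Finset.mem_insert, Finset.mem_singleton] at hk ⊢
      rcases hk with h | h | h | h <;> rw [h] at hkS
      · rcases only2 u0 S0 S4 S hu0 hS0 ((mS0 v).2 (Or.inl rfl)) ((mS0 u0).2 (by simp)) hS4
            ((mS4 v).2 (Or.inl rfl)) ((mS4 u0).2 (by simp)) (Ne.symm hS40) hS hvS hkS with h' | h'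
        · rw [h', mS0] at hz
          rcases hz with hz | hz | hz <;> simp only [hz, true_or, or_true]
        · rw [h', mS4] at hz
          rcases hz with hz | hz | hz <;> simp only [hz, true_or, or_true]
      · rcases only2 u1 S0 S1 S hu1 hS0 ((mS0 v).2 (Or.inl rfl)) ((mS0 u1).2 (by simp)) hS1
            ((mS1 v).2 (Or.inl rfl)) ((mS1 u1).2 (by simp)) (Ne.symm hS10) hS hvS hkS with h' | h'
        · rw [h', mS0] at hz
          rcases hz with hz | hz | hz <;> simp only [hz, true_or, or_true]
        · rw [h', mS1] at hz
          rcases hz with hz | hz | hz <;> simp only [hz, true_or, or_true]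
      · rcases only2 u2 S1 S2 S hu2 hS1 ((mS1 v).2 (Or.inl rfl)) ((mS1 u2).2 (by simp)) hS2
            ((mS2 v).2 (Or.inl rfl)) ((mS2 u2).2 (by simp)) (Ne.symm hS21) hS hvS hkS with h' | h'
        · rw [h', mS1] at hz
          rcases hz with hz | hz | hz <;> simp only [hz, true_or, or_true]
        · rw [h', mS2, h34] at hz
          rcases hz with hz | hz | hz <;> simp only [hz, true_or, or_true]
      · rcases only2 u4 S4 S2 S hu4 hS4 ((mS4 v).2 (Or.inl rfl)) ((mS4 u4).2 (by simp)) hS2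
            ((mS2 v).2 (Or.inl rfl)) ((mS2 u4).2 (by rw [← h34]; simp)) (hS4S2 h34) hS hvS hkS
            with h' | h'
        · rw [h', mS4] at hz
          rcases hz with hz | hz | hz <;> simp only [hz, true_or, or_true]
        · rw [h', mS2, h34] at hz
          rcases hz with hz | hz | hz <;> simp only [hz, true_or, or_true]
  -- the second fan triangle on `{v,u3}`: `S3 = {v,u3,u5}` with `u5 = u4`
  obtain ⟨u5, S3, hS3, hS32, hS3eq, hu5v, hu53, hu5⟩ :=
    next u3 S2 hu3 hS2 ((mS2 v).2 (Or.inl rfl)) ((mS2 u3).2 (by simp))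
  have mS3 : ∀ z, z ∈ S3 ↔ z = v ∨ z = u3 ∨ z = u5 := by
    intro z; rw [hS3eq]; simp only [Finset.mem_insert, Finset.mem_singleton]
  -- the five partners found exhaust the partners of `v`
  have cover : ∀ a, bond v a = true → a = u0 ∨ a = u1 ∨ a = u2 ∨ a = u3 ∨ a = u4 := by
    intro a ha
    have hKsub : ({u0, u1, u2, u3, u4} : Finset (Fin 12)) ⊆
        Finset.univ.filter fun w => bond v w = true := by
      intro k hk
      simp only [Finset.mem_insert, Finset.mem_singleton] at hk
      simp only [Finset.mem_filter, Finset.mem_univ, true_and]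
      rcases hk with h | h | h | h | h <;> rw [h] <;> assumption
    have hK5 : ({u0, u1, u2, u3, u4} : Finset (Fin 12)).card = 5 := by
      rw [Finset.card_insert_of_notMem, Finset.card_insert_of_notMem,
        Finset.card_eq_three.2 ⟨u2, u3, u4, hu32.symm, hu24, hu34, rfl⟩]
      · simp only [Finset.mem_insert, Finset.mem_singleton, not_or]
        exact ⟨hu21.symm, hu31.symm, hu14⟩
      · simp only [Finset.mem_insert, Finset.mem_singleton, not_or]
        exact ⟨hu10.symm, hu20.symm, hu30.symm, hu40.symm⟩
    have heq := Finset.eq_of_subset_of_card_le hKsub (by rw [hv, hK5])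
    have : a ∈ ({u0, u1, u2, u3, u4} : Finset (Fin 12)) := by rw [heq]; simpa using ha
    simpa only [Finset.mem_insert, Finset.mem_singleton] using this
  have hu54 : u5 = u4 := by
    rcases cover u5 hu5 with h | h | h | h | h
    · exfalso
      rcases only2 u0 S0 S4 S3 hu0 hS0 ((mS0 v).2 (Or.inl rfl)) ((mS0 u0).2 (by simp)) hS4
          ((mS4 v).2 (Or.inl rfl)) ((mS4 u0).2 (by simp)) (Ne.symm hS40) hS3
          ((mS3 v).2 (Or.inl rfl)) ((mS3 u0).2 (by rw [← h]; simp)) with h' | h'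
      · have := (mS3 u3).2 (Or.inr (Or.inl rfl))
        rw [h', mS0] at this
        rcases this with h1 | h1 | h1
        exacts [hu3v h1, hu30 h1, hu31 h1]
      · have := (mS3 u3).2 (Or.inr (Or.inl rfl))
        rw [h', mS4] at this
        rcases this with h1 | h1 | h1
        exacts [hu3v h1, hu30 h1, hu34 h1]
    · exfalso
      rcases only2 u1 S0 S1 S3 hu1 hS0 ((mS0 v).2 (Or.inl rfl)) ((mS0 u1).2 (by simp)) hS1
          ((mS1 v).2 (Or.inl rfl)) ((mS1 u1).2 (by simp)) (Ne.symm hS10) hS3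
          ((mS3 v).2 (Or.inl rfl)) ((mS3 u1).2 (by rw [← h]; simp)) with h' | h'
      · have := (mS3 u3).2 (Or.inr (Or.inl rfl))
        rw [h', mS0] at this
        rcases this with h1 | h1 | h1
        exacts [hu3v h1, hu30 h1, hu31 h1]
      · have := (mS3 u3).2 (Or.inr (Or.inl rfl))
        rw [h', mS1] at this
        rcases this with h1 | h1 | h1
        exacts [hu3v h1, hu31 h1, hu32 h1]
    · exfalso
      apply hS32
      rw [hS3eq, hS2eq, h, tri_swap23]
    · exact absurd h hu53
    · exact h
  have hS4' : S4 = {v, u4, u0} := by rw [hS4eq, tri_swap23]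
  have hS3' : S3 = {v, u3, u4} := by rw [hS3eq, hu54]
  -- PACKAGING
  refine ⟨![u0, u1, u2, u3, u4], ?_, ?_, ?_, ?_, ?_⟩
  · intro i j h
    fin_cases i <;> fin_cases j <;> simp at h ⊢ <;>
      first
      | exact absurd h ‹_›
      | exact absurd h.symm ‹_›
  · intro i
    fin_cases i <;> simp <;> assumption
  · intro a ha
    rcases cover a ha with h | h | h | h | h <;> subst a
    exacts [⟨0, by simp⟩, ⟨1, by simp⟩, ⟨2, by simp⟩, ⟨3, by simp⟩, ⟨4, by simp⟩]
  · intro i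
    fin_cases i
    · simpa [hS0eq] using hS0
    · simpa [hS1eq] using hS1
    · simpa [hS2eq] using hS2
    · simpa [hS3'] using hS3
    · simpa [hS4'] using hS4
  · intro S hS hvS
    obtain ⟨a, haS, hav⟩ : ∃ a ∈ S, a ≠ v := by
      obtain ⟨x, y, z, hxy, -, -, hxyz⟩ := Finset.card_eq_three.1 (tri_card S hS)
      by_cases hx : x = v
      · exact ⟨y, by rw [hxyz]; simp, fun h => hxy (hx.trans h.symm)⟩
      · exact ⟨x, by rw [hxyz]; simp, hx⟩
    have ha : bond v a = true := five_T v hv S hS hvS v hvS a haS hav.symm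
    rcases cover a ha with h | h | h | h | h <;> rw [h] at haS
    · rcases only2 u0 S0 S4 S hu0 hS0 ((mS0 v).2 (Or.inl rfl)) ((mS0 u0).2 (by simp)) hS4
          ((mS4 v).2 (Or.inl rfl)) ((mS4 u0).2 (by simp)) (Ne.symm hS40) hS hvS haS with h' | h'
      · exact ⟨0, by rw [h']; simpa using hS0eq⟩
      · exact ⟨4, by rw [h']; simpa using hS4'⟩
    · rcases only2 u1 S0 S1 S hu1 hS0 ((mS0 v).2 (Or.inl rfl)) ((mS0 u1).2 (by simp)) hS1
          ((mS1 v).2 (Or.inl rfl)) ((mS1 u1).2 (by simp)) (Ne.symm hS10) hS hvS haS with h' | h'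
      · exact ⟨0, by rw [h']; simpa using hS0eq⟩
      · exact ⟨1, by rw [h']; simpa using hS1eq⟩
    · rcases only2 u2 S1 S2 S hu2 hS1 ((mS1 v).2 (Or.inl rfl)) ((mS1 u2).2 (by simp)) hS2
          ((mS2 v).2 (Or.inl rfl)) ((mS2 u2).2 (by simp)) (Ne.symm hS21) hS hvS haS with h' | h'
      · exact ⟨1, by rw [h']; simpa using hS1eq⟩
      · exact ⟨2, by rw [h']; simpa using hS2eq⟩
    · rcases only2 u3 S2 S3 S hu3 hS2 ((mS2 v).2 (Or.inl rfl)) ((mS2 u3).2 (by simp)) hS3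
          ((mS3 v).2 (Or.inl rfl)) ((mS3 u3).2 (by simp)) (Ne.symm hS32) hS hvS haS with h' | h'
      · exact ⟨2, by rw [h']; simpa using hS2eq⟩
      · exact ⟨3, by rw [h']; simpa using hS3'⟩
    · have hS4S3 : S4 ≠ S3 := by
        intro he
        have := (mS4 u0).2 (Or.inr (Or.inl rfl))
        rw [he, mS3] at this
        rcases this with h1 | h1 | h1
        · exact (neN u0 hu0) h1
        · exact hu30 h1.symm
        · exact hu40 (by rw [← hu54, h1])
      rcases only2 u4 S4 S3 S hu4 hS4 ((mS4 v).2 (Or.inl rfl)) ((mS4 u4).2 (by simp)) hS3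
          ((mS3 v).2 (Or.inl rfl)) ((mS3 u4).2 (by rw [← hu54]; simp)) hS4S3 hS hvS haS
          with h' | h'
      · exact ⟨4, by rw [h']; simpa using hS4'⟩
      · exact ⟨3, by rw [h']; simpa using hS3'⟩

end FanData

/-- **Registered sub-goal `stub_ffrC5CorePentagon` (the link pentagon of a `5`-valent label).**
[folklore] -/
theorem stub_ffrC5CorePentagon (bond : Fin 12 → Fin 12 → Bool) (tri : Finset (Finset (Fin 12)))
    (bond_irrefl : ∀ v, bond v v = false) (tri_card : ∀ S ∈ tri, S.card = 3)
    (bond_side : ∀ v w, bond v w = true →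
      (tri.filter fun S' => ({v, w} : Finset (Fin 12)) ⊆ S').card = 2)
    (five_T : ∀ v, (Finset.univ.filter fun w => bond v w = true).card = 5 →
      ∀ S ∈ tri, v ∈ S → ∀ a ∈ S, ∀ b ∈ S, a ≠ b → bond a b = true)
    (v : Fin 12) (hv : (Finset.univ.filter fun w => bond v w = true).card = 5) :
    ∃ u : Fin 5 → Fin 12, Function.Injective u ∧ (∀ i, bond v (u i) = true) ∧
      (∀ a, bond v a = true → ∃ i, u i = a) ∧
      (∀ i, ({v, u i, u (i + 1)} : Finset (Fin 12)) ∈ tri) ∧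
      (∀ S ∈ tri, v ∈ S → ∃ i, S = {v, u i, u (i + 1)}) :=
  ffrCC_pentagon bond_irrefl tri_card bond_side five_T v hv

end Summit.AtomisticToContinuum.Crystallization.Theorems

end
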